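import Literature.Barriers.FinalStateConjecture.TrappingDerivativeLossGeodesicBeamsProofs
import Literature.Barriers.FinalStateConjecture.TrappingDerivativeLossOrbit
import Literature.Geometry.Lorentzian.KerrSchildWaveCauchyProblemProofs
import HarnessLib

/-!
# Discharges of named facts of `TrappingDerivativeLossProofs.lean`

`Literature/Barriers/FinalStateConjecture/TrappingDerivativeLossProofsHolds.lean` —
proofs-only sibling of `TrappingDerivativeLossProofs.lean` (no definitions, no named facts).
Each theorem below closes a named fact `X : Prop` of that file as `X_holds : X` by composing
an ACCEPTED reduction theorem of the tree with the ACCEPTED unconditional `_holds` discharges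
of all of its hypotheses; nothing is re-proved and no statement is changed. Recorded by the
librarian sweep g25 (2026-08-16, pass 5c: facts dischargeable in one line from the tree's own
lemmas), so that the facts census, `#h21_route_deps` and the cone guardrail see these facts as
theorems.

Discharged here:

* `SbierskiKerrLocalisedSolutions_holds` := `of_waveCauchyProblem_of_nullGeodesicBeams`
  `waveCauchyProblem_holds` `KerrNullGeodesicGaussianBeams_holds`
  (`TrappingDerivativeLossOrbit.lean`).

## References

* [Sbierski2015] — see `lean/references.bib` and the docstring of the fact in `TrappingDerivativeLossProofs.lean`.
-/

namespace Literature.Barriers.FinalStateConjecture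

/-- **Discharge of the named fact `SbierskiKerrLocalisedSolutions`**
(`TrappingDerivativeLossProofs.lean`): Sbierski's localised solutions along the trapped null
geodesics of Kerr (named fact; the PDE input of Thm. 7.4). Sbierski, Anal. PDE 8 (2015), Thm.
5.1: on a time-oriented globally hyperbolic `(M, g)` with time function `t`, `Σ₀` Cauchy, … —
obtained as `of_waveCauchyProblem_of_nullGeodesicBeams` applied to the tree's unconditional
discharges `waveCauchyProblem_holds`, `KerrNullGeodesicGaussianBeams_holds` of its hypotheses
(reduction in `TrappingDerivativeLossOrbit.lean`).
[cite: Sbierski2015, Thm. 5.1 and §7A] -/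
theorem SbierskiKerrLocalisedSolutions_holds :
    SbierskiKerrLocalisedSolutions :=
  Literature.Barriers.FinalStateConjecture.SbierskiKerrLocalisedSolutions.of_waveCauchyProblem_of_nullGeodesicBeams
    Literature.Geometry.Lorentzian.KerrSchild.waveCauchyProblem_holds
    KerrNullGeodesicGaussianBeams_holds

end Literature.Barriers.FinalStateConjecture
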